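import Summits.PneNP.PneNP.Theorems.CliqueExtLowerBound.Negative.AnchoredThetaCounting
import Summits.PneNP.PneNP.Theorems.CliqueExtLowerBound.Negative.AnchoredThetaHelpers

/-!
# Asymptotics of `⌈m^{1/4}⌉₊`, `⌊m^{1/8}⌋₊` and the two numeric budgets (anchored-theta refutation, parts F, G)

Part of the refutation of `stub_convReplaceable` (line `width-threshold-certificate-sparsity` of
crux stmt-PneNP-10682, `ConvexRankGates.CliqueExtLowerBound`) by the ANCHORED THETA GATE; the final
theorem is `stub_convReplaceable_false` in `ConvReplaceableFalse.lean`, whose module docstring has the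
overview. Witness: at `c = 3`, for every `a`, localities `r = 3, s = 4`, at every large `m = n + 2`, the
theta programme on the `n+1` non-anchor vertices with clique parameter `k-1` (`k = ⌈m^{1/4}⌉₊`), fed
with children `d_j = {{e₀, p_j}}`, `c_j = {{e₀, f(α,γ), f(β,γ)} : γ < h}`, is not replaceable by any
monotone circuit of size `m^a`: Jukna's criterion on the derived coordinates kills both exits.
-/

set_option linter.dupNamespace false

namespace Summit.PneNP.PneNP.Theorems.CliqueExtLowerBound.Negative

open Literature.Computability.Complexity Literature.Combinatorics.SimpleGraph Matrix Finset Filter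

noncomputable section

/-! ## F. Asymptotics of the line's parameters `k = ⌈m^{1/4}⌉₊`, `D = ⌊m^{1/8}⌋₊` -/

section Asymptotics

/-- `(m^{1/4})⁴ = m`. -/
theorem rpow_quarter_pow_four (m : ℕ) : (((m : ℝ) ^ (1 / 4 : ℝ)) ^ 4) = (m : ℝ) := by
  rw [← Real.rpow_natCast, ← Real.rpow_mul (Nat.cast_nonneg m)]
  norm_num

/-- `(m^{1/8})⁸ = m`. -/
theorem rpow_eighth_pow_eight (m : ℕ) : (((m : ℝ) ^ (1 / 8 : ℝ)) ^ 8) = (m : ℝ) := by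
  rw [← Real.rpow_natCast, ← Real.rpow_mul (Nat.cast_nonneg m)]
  norm_num

/-- `m ≤ k⁴ ≤ 16 m` for `k = ⌈m^{1/4}⌉₊`, `m ≥ 1`. -/
theorem ceil_quarter_bounds (m : ℕ) (hm : 1 ≤ m) :
    m ≤ (⌈(m : ℝ) ^ (1 / 4 : ℝ)⌉₊) ^ 4 ∧ (⌈(m : ℝ) ^ (1 / 4 : ℝ)⌉₊) ^ 4 ≤ 16 * m := by
  set x : ℝ := (m : ℝ) ^ (1 / 4 : ℝ) with hx
  have hx0 : 0 ≤ x := by positivity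
  have hx1 : 1 ≤ x := Real.one_le_rpow (by exact_mod_cast hm) (by norm_num)
  have hxm : x ^ 4 = m := rpow_quarter_pow_four m
  have h1 : x ≤ ⌈x⌉₊ := Nat.le_ceil x
  have h2 : (⌈x⌉₊ : ℝ) < x + 1 := Nat.ceil_lt_add_one hx0
  constructor
  · have : (m : ℝ) ≤ ((⌈x⌉₊ ^ 4 : ℕ) : ℝ) := by
      rw [← hxm]; push_cast
      exact pow_le_pow_left₀ hx0 h1 4
    exact_mod_cast this
  · have h3 : (⌈x⌉₊ : ℝ) ≤ 2 * x := by linarith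
    have : ((⌈x⌉₊ ^ 4 : ℕ) : ℝ) ≤ ((16 * m : ℕ) : ℝ) := by
      push_cast
      calc (⌈x⌉₊ : ℝ) ^ 4 ≤ (2 * x) ^ 4 := pow_le_pow_left₀ (by positivity) h3 4
        _ = 16 * x ^ 4 := by ring
        _ = 16 * m := by rw [hxm]
    exact_mod_cast this

/-- `D⁸ ≤ m < (D+1)⁸` and `1 ≤ D` for `D = ⌊m^{1/8}⌋₊`, `m ≥ 1`. -/
theorem floor_eighth_bounds (m : ℕ) (hm : 1 ≤ m) :
    (⌊(m : ℝ) ^ (1 / 8 : ℝ)⌋₊) ^ 8 ≤ m ∧ m < (⌊(m : ℝ) ^ (1 / 8 : ℝ)⌋₊ + 1) ^ 8 ∧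
      1 ≤ ⌊(m : ℝ) ^ (1 / 8 : ℝ)⌋₊ := by
  set y : ℝ := (m : ℝ) ^ (1 / 8 : ℝ) with hy
  have hy0 : 0 ≤ y := by positivity
  have hy1 : 1 ≤ y := Real.one_le_rpow (by exact_mod_cast hm) (by norm_num)
  have hym : y ^ 8 = m := rpow_eighth_pow_eight m
  have h1 : (⌊y⌋₊ : ℝ) ≤ y := Nat.floor_le hy0
  have h2 : y < ⌊y⌋₊ + 1 := Nat.lt_floor_add_one y
  refine ⟨?_, ?_, ?_⟩
  · have : ((⌊y⌋₊ ^ 8 : ℕ) : ℝ) ≤ (m : ℝ) := by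
      rw [← hym]; push_cast
      exact pow_le_pow_left₀ (by positivity) h1 8
    exact_mod_cast this
  · have : (m : ℝ) < (((⌊y⌋₊ + 1) ^ 8 : ℕ) : ℝ) := by
      rw [← hym]; push_cast
      exact pow_lt_pow_left₀ h2 hy0 (by norm_num)
    exact_mod_cast this
  · exact Nat.le_floor (by exact_mod_cast hy1)

/-- `⌊√⌊m^{1/8}⌋₊⌋ → ∞`. -/
theorem tendsto_sqrt_floor_eighth :
    Tendsto (fun m : ℕ => Nat.sqrt ⌊(m : ℝ) ^ (1 / 8 : ℝ)⌋₊) atTop atTop := by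
  refine tendsto_atTop_atTop.2 fun b => ⟨(b ^ 2) ^ 8, fun m hm => ?_⟩
  rw [Nat.le_sqrt, ← sq]
  refine Nat.le_floor ?_
  have h1 : (((b : ℝ) ^ 2) ^ 8) ≤ m := by exact_mod_cast hm
  have h2 : ((b : ℝ) ^ 2) = (((b : ℝ) ^ 2) ^ 8) ^ (1 / 8 : ℝ) := by
    rw [← Real.rpow_natCast _ 8, ← Real.rpow_mul (by positivity)]
    norm_num
  rw [Nat.cast_pow, h2]
  exact Real.rpow_le_rpow (by positivity) h1 (by norm_num)

/-- Exponential beats polynomial along the line's parameters: eventually `4 m (2/3)^{⌊√D⌋} ≤ 1`. -/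
theorem eventually_decay :
    ∀ᶠ m : ℕ in atTop, 4 * (m : ℝ) * (2 / 3 : ℝ) ^ Nat.sqrt ⌊(m : ℝ) ^ (1 / 8 : ℝ)⌋₊ ≤ 1 := by
  have hlim := tendsto_pow_const_mul_const_pow_of_abs_lt_one 16 (r := (2 / 3 : ℝ))
    (by rw [abs_of_nonneg (by norm_num)]; norm_num)
  have hc : (0 : ℝ) < 1 / (4 * 2 ^ 16) := by norm_num
  have hev : ∀ᶠ q : ℕ in atTop, (q : ℝ) ^ 16 * (2 / 3 : ℝ) ^ q < 1 / (4 * 2 ^ 16) :=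
    (tendsto_order.1 hlim).2 _ hc
  have hev1 : ∀ᶠ q : ℕ in atTop, 1 ≤ q := eventually_ge_atTop 1
  have key := tendsto_sqrt_floor_eighth.eventually (hev.and hev1)
  have hm1 : ∀ᶠ m : ℕ in atTop, 1 ≤ m := eventually_ge_atTop 1
  filter_upwards [key, hm1] with m hm hm1'
  obtain ⟨hq, hq1⟩ := hm
  set D := ⌊(m : ℝ) ^ (1 / 8 : ℝ)⌋₊ with hD
  set q := Nat.sqrt D with hq'
  -- m < (D+1)^8 ≤ (q+1)^16 ≤ (2q)^16
  have h1 : m < (D + 1) ^ 8 := (floor_eighth_bounds m hm1').2.1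
  have h2 : D + 1 ≤ (q + 1) ^ 2 := Nat.succ_le_of_lt (Nat.lt_succ_sqrt' D)
  have h3 : (D + 1) ^ 8 ≤ (q + 1) ^ 16 := by
    calc (D + 1) ^ 8 ≤ ((q + 1) ^ 2) ^ 8 := Nat.pow_le_pow_left h2 8
      _ = (q + 1) ^ 16 := by ring
  have h4 : (q + 1) ^ 16 ≤ (2 * q) ^ 16 := Nat.pow_le_pow_left (by omega) 16
  have hmq : (m : ℝ) ≤ (2 * (q : ℝ)) ^ 16 := by
    have : m ≤ (2 * q) ^ 16 := by omega
    exact_mod_cast this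
  have hpos : (0 : ℝ) ≤ (2 / 3 : ℝ) ^ q := by positivity
  calc 4 * (m : ℝ) * (2 / 3 : ℝ) ^ q ≤ 4 * (2 * (q : ℝ)) ^ 16 * (2 / 3 : ℝ) ^ q := by
        gcongr
    _ = 4 * 2 ^ 16 * ((q : ℝ) ^ 16 * (2 / 3 : ℝ) ^ q) := by ring
    _ ≤ 4 * 2 ^ 16 * (1 / (4 * 2 ^ 16)) := by gcongr
    _ = 1 := by norm_num

/-- Bernoulli: `(1 - 1/(2D))^D ≤ 2/3` for `D ≥ 1`. -/
theorem one_sub_pow_le_two_thirds (D : ℕ) (hD : 1 ≤ D) : (1 - 1 / (2 * (D : ℝ))) ^ D ≤ 2 / 3 := by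
  have hDpos : (0 : ℝ) < D := by exact_mod_cast hD
  have hD1 : (1 : ℝ) ≤ D := by exact_mod_cast hD
  set x : ℝ := 1 / (2 * (D : ℝ)) with hx
  have hx0 : 0 ≤ x := by positivity
  have hx1 : x ≤ 1 / 2 := by
    rw [hx, div_le_div_iff₀ (by positivity) (by norm_num)]
    linarith
  have hB : 1 + (D : ℝ) * x ≤ (1 + x) ^ D := one_add_mul_le_pow (by linarith) D
  have hDx : (D : ℝ) * x = 1 / 2 := by rw [hx]; field_simp
  have h1 : (1 - x) ^ D * (1 + x) ^ D ≤ 1 := by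
    rw [← mul_pow]
    have : (1 - x) * (1 + x) ≤ 1 := by nlinarith
    exact pow_le_one₀ (by nlinarith) this
  have h2 : 0 ≤ (1 - x) ^ D := pow_nonneg (by linarith) D
  have h3 : (1 - x) ^ D * (3 / 2) ≤ 1 := by
    calc (1 - x) ^ D * (3 / 2) = (1 - x) ^ D * (1 + (D : ℝ) * x) := by rw [hDx]; ring
      _ ≤ (1 - x) ^ D * (1 + x) ^ D := mul_le_mul_of_nonneg_left hB h2
      _ ≤ 1 := h1
  linarith

/-- The number of edge slots of `K_{n+2}` is `C(n+2, 2)`. -/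
theorem card_EV (n : ℕ) : Fintype.card (EV n) = (n + 2).choose 2 := by
  rw [← SimpleGraph.edgeFinset_card, SimpleGraph.card_edgeFinset_top_eq_card_choose_two,
    Fintype.card_fin]

end Asymptotics

/-! ## G. The numeric side conditions, and the refutation -/

section Numeric

/-- The positive-side budget (hypothesis `Hii` of `casePos_absurd`) at the line's parameters. -/
theorem numeric_pos (n k a s1 : ℕ) (hk3 : 3 ≤ k) (hkw : w0 a + 1 ≤ k) (hkn : k ≤ n + 2)
    (hk16 : k ^ 4 ≤ 16 * (n + 2)) (h4sk : 4 * s1 * k ≤ n)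
    (hT2 : 4 * s1 ^ rr a * 256 ^ (a + 1) ≤ n + 2) (h16 : 16 ≤ n + 2) :
    (1 / (8 * ((n + 2 : ℕ) : ℝ) ^ (3 + 1))) * ((n + 2).choose k : ℝ) +
      (s1 : ℝ) * ((n - 1).choose (k - 3) : ℝ) +
      (((n + 2) ^ a * s1 ^ rr a : ℕ) : ℝ) * ((n + 1 - w0 a).choose (k - 1 - w0 a) : ℝ) <
      (n.choose (k - 2) : ℝ) := by
  set C := n.choose (k - 2) with hC
  have hkn2 : k - 2 ≤ n := by omega
  have hCpos : 1 ≤ C := Nat.choose_pos hkn2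
  -- (a) C(n+2, k) ≤ (n+2)² C
  have ha : (n + 2).choose k ≤ (n + 2) ^ 2 * C := by
    have hmul := Nat.choose_mul (n := n + 2) (k := k) (s := 2) (by omega)
    -- hmul : (n+2).choose k * k.choose 2 = (n+2).choose 2 * (n + 2 - 2).choose (k - 2)
    have h2 : 1 ≤ k.choose 2 := Nat.choose_pos (by omega)
    have h3 : (n + 2).choose 2 ≤ (n + 2) ^ 2 := Nat.choose_le_pow _ _
    calc (n + 2).choose k ≤ (n + 2).choose k * k.choose 2 := Nat.le_mul_of_pos_right _ h2
      _ = (n + 2).choose 2 * (n + 2 - 2).choose (k - 2) := hmul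
      _ = (n + 2).choose 2 * C := by rw [hC]; rfl
      _ ≤ (n + 2) ^ 2 * C := Nat.mul_le_mul_right _ h3
  -- (b) 4 s1 C(n-1, k-3) ≤ C
  have hb : 4 * s1 * (n - 1).choose (k - 3) ≤ C := by
    rcases Nat.eq_zero_or_pos n with hn0 | hnpos
    · subst hn0
      have : k - 2 = 0 := by omega
      omega
    have hid := Nat.add_one_mul_choose_eq (n - 1) (k - 3)
    rw [show n - 1 + 1 = n by omega, show k - 3 + 1 = k - 2 by omega] at hid
    -- hid : n * (n-1).choose (k-3) = C * (k - 2)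
    refine Nat.le_of_mul_le_mul_right ?_ hnpos
    calc 4 * s1 * (n - 1).choose (k - 3) * n = 4 * s1 * (n * (n - 1).choose (k - 3)) := by ring
      _ = 4 * s1 * (C * (k - 2)) := by rw [hid]
      _ = C * (4 * s1 * (k - 2)) := by ring
      _ ≤ C * n := Nat.mul_le_mul_left _ (by
          calc 4 * s1 * (k - 2) ≤ 4 * s1 * k := Nat.mul_le_mul_left _ (Nat.sub_le _ _)
            _ ≤ n := h4sk)
  -- (c) 4 (n+2)^a s1^R C(n+1-w0, k-1-w0) ≤ C
  have hc : 4 * ((n + 2) ^ a * s1 ^ rr a) * (n + 1 - w0 a).choose (k - 1 - w0 a) ≤ C := by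
    set X := (n + 1 - w0 a).choose (k - 1 - w0 a) with hX
    have hw1 : w0 a - 1 = 4 * (a + 1) := by rw [w0_eq]; omega
    have hratio := choose_sub_sub_mul_pow_le n (k - 2) hkn2 (w0 a - 1) (by omega)
    rw [show n - (w0 a - 1) = n + 1 - w0 a by rw [w0_eq]; omega,
      show k - 2 - (w0 a - 1) = k - 1 - w0 a by rw [w0_eq]; omega, hw1] at hratio
    -- hratio : X * n ^ (4 (a+1)) ≤ C * (k - 2) ^ (4 (a+1))
    have h1 : (k - 2) ^ (4 * (a + 1)) ≤ (16 * (n + 2)) ^ (a + 1) := by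
      calc (k - 2) ^ (4 * (a + 1)) ≤ k ^ (4 * (a + 1)) := Nat.pow_le_pow_left (Nat.sub_le _ _) _
        _ = (k ^ 4) ^ (a + 1) := by rw [pow_mul]
        _ ≤ (16 * (n + 2)) ^ (a + 1) := Nat.pow_le_pow_left hk16 _
    have h2 : (n + 2) ^ 4 ≤ 16 * n ^ 4 := by
      have : n + 2 ≤ 2 * n := by omega
      calc (n + 2) ^ 4 ≤ (2 * n) ^ 4 := Nat.pow_le_pow_left this 4
        _ = 16 * n ^ 4 := by ring
    have h3 : X * (n + 2) ^ (4 * (a + 1)) ≤ 256 ^ (a + 1) * (n + 2) ^ (a + 1) * C := by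
      calc X * (n + 2) ^ (4 * (a + 1)) = X * ((n + 2) ^ 4) ^ (a + 1) := by rw [pow_mul]
        _ ≤ X * (16 * n ^ 4) ^ (a + 1) := Nat.mul_le_mul_left _ (Nat.pow_le_pow_left h2 _)
        _ = 16 ^ (a + 1) * (X * n ^ (4 * (a + 1))) := by rw [mul_pow, ← pow_mul]; ring
        _ ≤ 16 ^ (a + 1) * (C * (k - 2) ^ (4 * (a + 1))) := Nat.mul_le_mul_left _ hratio
        _ ≤ 16 ^ (a + 1) * (C * (16 * (n + 2)) ^ (a + 1)) :=
            Nat.mul_le_mul_left _ (Nat.mul_le_mul_left _ h1)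
        _ = 256 ^ (a + 1) * (n + 2) ^ (a + 1) * C := by
            rw [mul_pow, show (256 : ℕ) ^ (a + 1) = 16 ^ (a + 1) * 16 ^ (a + 1) by
              rw [← mul_pow]; norm_num]
            ring
    have hpos : 0 < (n + 2) ^ (4 * (a + 1)) := Nat.pow_pos (by omega)
    refine Nat.le_of_mul_le_mul_right ?_ hpos
    calc 4 * ((n + 2) ^ a * s1 ^ rr a) * X * (n + 2) ^ (4 * (a + 1))
        = 4 * (n + 2) ^ a * s1 ^ rr a * (X * (n + 2) ^ (4 * (a + 1))) := by ring
      _ ≤ 4 * (n + 2) ^ a * s1 ^ rr a * (256 ^ (a + 1) * (n + 2) ^ (a + 1) * C) :=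
          Nat.mul_le_mul_left _ h3
      _ = (4 * s1 ^ rr a * 256 ^ (a + 1)) * ((n + 2) ^ a * (n + 2) ^ (a + 1)) * C := by ring
      _ ≤ (n + 2) * ((n + 2) ^ a * (n + 2) ^ (a + 1)) * C := by gcongr
      _ = (n + 2) ^ (2 * a + 2) * C := by ring
      _ ≤ (n + 2) ^ (4 * (a + 1)) * C :=
          Nat.mul_le_mul_right _ (Nat.pow_le_pow_right (by omega) (by omega))
      _ = C * (n + 2) ^ (4 * (a + 1)) := by ring
  -- assemble in ℝ
  have hm0 : (0 : ℝ) < ((n + 2 : ℕ) : ℝ) := by positivity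
  have haR : ((n + 2).choose k : ℝ) ≤ ((n + 2 : ℕ) : ℝ) ^ 2 * C := by exact_mod_cast ha
  have hbR : 4 * (s1 : ℝ) * ((n - 1).choose (k - 3) : ℝ) ≤ C := by exact_mod_cast hb
  have hcR : 4 * (((n + 2) ^ a * s1 ^ rr a : ℕ) : ℝ) * ((n + 1 - w0 a).choose (k - 1 - w0 a) : ℝ) ≤ C := by
    exact_mod_cast hc
  have hCR : (1 : ℝ) ≤ C := by exact_mod_cast hCpos
  have h1 : (1 / (8 * ((n + 2 : ℕ) : ℝ) ^ (3 + 1))) * ((n + 2).choose k : ℝ) ≤ (C : ℝ) / 8 := by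
    have hm1 : (1 : ℝ) ≤ ((n + 2 : ℕ) : ℝ) := by exact_mod_cast (show 1 ≤ n + 2 by omega)
    have hm2 : ((n + 2 : ℕ) : ℝ) ^ 2 ≤ ((n + 2 : ℕ) : ℝ) ^ (3 + 1) := pow_le_pow_right₀ hm1 (by norm_num)
    rw [div_mul_eq_mul_div, one_mul, div_le_div_iff₀ (by positivity) (by norm_num)]
    calc ((n + 2).choose k : ℝ) * 8 ≤ ((n + 2 : ℕ) : ℝ) ^ 2 * C * 8 := by gcongr
      _ ≤ ((n + 2 : ℕ) : ℝ) ^ (3 + 1) * C * 8 := by gcongr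
      _ = C * (8 * ((n + 2 : ℕ) : ℝ) ^ (3 + 1)) := by ring
  linarith

/-- The negative-side budget (hypothesis `Hi` of `caseNeg_absurd`) at the line's parameters. -/
theorem numeric_neg (n NN t h q Dm a Cm s' : ℕ) (hD1 : 1 ≤ Dm) (hDn : Dm ≤ n + 2)
    (htD : NN < Dm * (t + 1)) (h4D : 4 * Dm ≤ NN) (ht1 : 1 ≤ t)
    (htN : t ≤ NN) (hhN : h ≤ NN - 1) (hhq : h = Dm * q)
    (hdec : 4 * ((n + 2 : ℕ) : ℝ) * (2 / 3 : ℝ) ^ q ≤ 1)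
    (hCm : 4 * (Cm * ((s' + 1) * s' ^ s')) * 256 ^ (a + 1) ≤ (n + 2) ^ (a + 1))
    (hn8 : n + 2 < (Dm + 1) ^ 8) :
    (n + 1 : ℝ) * ((NN - 1 - h).choose (t - 1) : ℝ) +
      (1 / (8 * ((n + 2 : ℕ) : ℝ) ^ (3 + 1))) * (NN.choose t : ℝ) +
      (Cm : ℝ) * ((((s' : ℕ) : ℝ) + 1) * ((s' : ℕ) : ℝ) ^ s' * ((NN - 1).choose (t - 1) : ℝ) /
        (Dm : ℝ) ^ (8 * (a + 1))) <
      ((NN - 1).choose (t - 1) : ℝ) := by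
  set B := (NN - 1).choose (t - 1) with hB
  have hBpos : 1 ≤ B := Nat.choose_pos (by omega)
  have hBR : (1 : ℝ) ≤ B := by exact_mod_cast hBpos
  have hB0 : (0 : ℝ) ≤ B := by positivity
  have hNN1 : 1 ≤ NN := by omega
  -- (i-c) 4 Cm S ≤ Dm^{8(a+1)}
  have hc : 4 * (Cm * ((s' + 1) * s' ^ s')) ≤ Dm ^ (8 * (a + 1)) := by
    have h1 : n + 2 ≤ 256 * Dm ^ 8 := by
      calc n + 2 ≤ (Dm + 1) ^ 8 := hn8.le
        _ ≤ (2 * Dm) ^ 8 := Nat.pow_le_pow_left (by omega) 8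
        _ = 256 * Dm ^ 8 := by ring
    have h2 : (n + 2) ^ (a + 1) ≤ 256 ^ (a + 1) * Dm ^ (8 * (a + 1)) := by
      calc (n + 2) ^ (a + 1) ≤ (256 * Dm ^ 8) ^ (a + 1) := Nat.pow_le_pow_left h1 _
        _ = 256 ^ (a + 1) * Dm ^ (8 * (a + 1)) := by rw [mul_pow, ← pow_mul]
    have hpos : 0 < 256 ^ (a + 1) := Nat.pow_pos (by norm_num)
    refine Nat.le_of_mul_le_mul_right ?_ hpos
    calc 4 * (Cm * ((s' + 1) * s' ^ s')) * 256 ^ (a + 1) ≤ (n + 2) ^ (a + 1) := hCm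
      _ ≤ 256 ^ (a + 1) * Dm ^ (8 * (a + 1)) := h2
      _ = Dm ^ (8 * (a + 1)) * 256 ^ (a + 1) := by ring
  have hcR : 4 * ((Cm : ℝ) * ((((s' : ℕ) : ℝ) + 1) * ((s' : ℕ) : ℝ) ^ s')) ≤ (Dm : ℝ) ^ (8 * (a + 1)) := by
    exact_mod_cast hc
  have hDpow : (0 : ℝ) < (Dm : ℝ) ^ (8 * (a + 1)) := by positivity
  have U3 : (Cm : ℝ) * ((((s' : ℕ) : ℝ) + 1) * ((s' : ℕ) : ℝ) ^ s' * (B : ℝ) / (Dm : ℝ) ^ (8 * (a + 1))) ≤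
      (B : ℝ) / 4 := by
    rw [mul_div_assoc', div_le_div_iff₀ hDpow (by norm_num)]
    calc (Cm : ℝ) * ((((s' : ℕ) : ℝ) + 1) * ((s' : ℕ) : ℝ) ^ s' * (B : ℝ)) * 4
        = (4 * ((Cm : ℝ) * ((((s' : ℕ) : ℝ) + 1) * ((s' : ℕ) : ℝ) ^ s'))) * B := by ring
      _ ≤ (Dm : ℝ) ^ (8 * (a + 1)) * B := mul_le_mul_of_nonneg_right hcR hB0
      _ = B * (Dm : ℝ) ^ (8 * (a + 1)) := by ring
  -- (i-b) C(NN, t) ≤ 2 Dm B, so ε C(NN,t) ≤ B/4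
  have hb : NN.choose t ≤ 2 * Dm * B := by
    have hid := Nat.add_one_mul_choose_eq (NN - 1) (t - 1)
    rw [show NN - 1 + 1 = NN by omega, show t - 1 + 1 = t by omega] at hid
    -- hid : NN * B = NN.choose t * t
    have h1 : NN ≤ 2 * Dm * t := by nlinarith
    refine Nat.le_of_mul_le_mul_right ?_ (show 0 < t by omega)
    calc NN.choose t * t = NN * B := hid.symm
      _ ≤ 2 * Dm * t * B := Nat.mul_le_mul_right _ h1
      _ = 2 * Dm * B * t := by ring
  have U2 : (1 / (8 * ((n + 2 : ℕ) : ℝ) ^ (3 + 1))) * (NN.choose t : ℝ) ≤ (B : ℝ) / 4 := by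
    have hbR : (NN.choose t : ℝ) ≤ 2 * (Dm : ℝ) * B := by exact_mod_cast hb
    have hm1 : (1 : ℝ) ≤ ((n + 2 : ℕ) : ℝ) := by exact_mod_cast (show 1 ≤ n + 2 by omega)
    have hDm : (Dm : ℝ) ≤ ((n + 2 : ℕ) : ℝ) := by exact_mod_cast hDn
    have hm4 : ((n + 2 : ℕ) : ℝ) ≤ ((n + 2 : ℕ) : ℝ) ^ (3 + 1) := by
      calc ((n + 2 : ℕ) : ℝ) = ((n + 2 : ℕ) : ℝ) ^ 1 := (pow_one _).symm
        _ ≤ ((n + 2 : ℕ) : ℝ) ^ (3 + 1) := pow_le_pow_right₀ hm1 (by norm_num)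
    rw [div_mul_eq_mul_div, one_mul, div_le_div_iff₀ (by positivity) (by norm_num)]
    calc (NN.choose t : ℝ) * 4 ≤ 2 * (Dm : ℝ) * B * 4 := by gcongr
      _ = B * (8 * (Dm : ℝ)) := by ring
      _ ≤ B * (8 * ((n + 2 : ℕ) : ℝ) ^ (3 + 1)) := by gcongr; exact hDm.trans hm4
  -- (i-a) (n+1) C(NN-1-h, t-1) ≤ B/4
  have U1 : (n + 1 : ℝ) * ((NN - 1 - h).choose (t - 1) : ℝ) ≤ (B : ℝ) / 4 := by
    have hratio := choose_sub_mul_pow_le (NN - 1) (t - 1) h hhN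
    rw [show NN - 1 - (t - 1) = NN - t by omega] at hratio
    -- hratio : C(NN-1-h, t-1) * (NN-1)^h ≤ B * (NN - t)^h
    have hNN1R : (0 : ℝ) < ((NN - 1 : ℕ) : ℝ) := by
      have : 1 ≤ NN - 1 := by omega
      exact_mod_cast this
    have hratioR : (((NN - 1 - h).choose (t - 1) : ℕ) : ℝ) * ((NN - 1 : ℕ) : ℝ) ^ h ≤
        (B : ℝ) * ((NN - t : ℕ) : ℝ) ^ h := by exact_mod_cast hratio
    -- the ratio (NN - t)/(NN - 1) ≤ 1 - 1/(2 Dm)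
    have hkey : ((NN - t : ℕ) : ℝ) ≤ ((NN - 1 : ℕ) : ℝ) * (1 - 1 / (2 * (Dm : ℝ))) := by
      have hDR : (0 : ℝ) < Dm := by exact_mod_cast hD1
      have e1 : ((NN - t : ℕ) : ℝ) = (NN : ℝ) - t := by push_cast [Nat.cast_sub htN]; ring
      have e2 : ((NN - 1 : ℕ) : ℝ) = (NN : ℝ) - 1 := by push_cast [Nat.cast_sub hNN1]; ring
      rw [e1, e2]
      have h2 : (NN : ℝ) + 2 * Dm ≤ 2 * Dm * t + 1 := by
        have : NN + 2 * Dm ≤ 2 * Dm * t + 1 := by nlinarith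
        exact_mod_cast this
      have hDR2 : (0 : ℝ) < 2 * Dm := by positivity
      have key : ((NN : ℝ) - 1) / (2 * Dm) ≤ (t : ℝ) - 1 := by
        rw [div_le_iff₀ hDR2]; nlinarith
      have e3 : ((NN : ℝ) - 1) * (1 - 1 / (2 * Dm)) = (NN - 1) - (NN - 1) / (2 * Dm) := by ring
      rw [e3]
      linarith [key]
    have hfac0 : (0 : ℝ) ≤ 1 - 1 / (2 * (Dm : ℝ)) := by
      have hDR : (1 : ℝ) ≤ Dm := by exact_mod_cast hD1
      have : 1 / (2 * (Dm : ℝ)) ≤ 1 / 2 := by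
        rw [div_le_div_iff₀ (by positivity) (by norm_num)]; linarith
      linarith
    have hpow : ((NN - t : ℕ) : ℝ) ^ h ≤ ((NN - 1 : ℕ) : ℝ) ^ h * (1 - 1 / (2 * (Dm : ℝ))) ^ h := by
      rw [← mul_pow]
      exact pow_le_pow_left₀ (by positivity) hkey h
    have hbern : (1 - 1 / (2 * (Dm : ℝ))) ^ h ≤ (2 / 3 : ℝ) ^ q := by
      rw [hhq, pow_mul]
      exact pow_le_pow_left₀ (pow_nonneg hfac0 _) (one_sub_pow_le_two_thirds Dm hD1) q
    -- combine: C(NN-1-h,t-1) ≤ B (2/3)^q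
    have hX : (((NN - 1 - h).choose (t - 1) : ℕ) : ℝ) ≤ (B : ℝ) * (2 / 3 : ℝ) ^ q := by
      have hpos : (0 : ℝ) < ((NN - 1 : ℕ) : ℝ) ^ h := by positivity
      have := calc (((NN - 1 - h).choose (t - 1) : ℕ) : ℝ) * ((NN - 1 : ℕ) : ℝ) ^ h
          ≤ (B : ℝ) * ((NN - t : ℕ) : ℝ) ^ h := hratioR
        _ ≤ (B : ℝ) * (((NN - 1 : ℕ) : ℝ) ^ h * (1 - 1 / (2 * (Dm : ℝ))) ^ h) :=
            mul_le_mul_of_nonneg_left hpow hB0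
        _ ≤ (B : ℝ) * (((NN - 1 : ℕ) : ℝ) ^ h * (2 / 3 : ℝ) ^ q) := by gcongr
        _ = (B : ℝ) * (2 / 3 : ℝ) ^ q * ((NN - 1 : ℕ) : ℝ) ^ h := by ring
      exact le_of_mul_le_mul_right this hpos
    have hn1 : (n + 1 : ℝ) ≤ ((n + 2 : ℕ) : ℝ) := by push_cast; linarith
    calc (n + 1 : ℝ) * ((NN - 1 - h).choose (t - 1) : ℝ) ≤ ((n + 2 : ℕ) : ℝ) * ((B : ℝ) * (2 / 3 : ℝ) ^ q) := by
          gcongr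
      _ = (B : ℝ) / 4 * (4 * ((n + 2 : ℕ) : ℝ) * (2 / 3 : ℝ) ^ q) := by ring
      _ ≤ (B : ℝ) / 4 * 1 := by gcongr
      _ = (B : ℝ) / 4 := by ring
  linarith

end Numeric

end

end Summit.PneNP.PneNP.Theorems.CliqueExtLowerBound.Negative
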